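import Summits.NavierStokesRegularity.NavierStokesRegularity.Theses.AxisymmetricExtremality
import Summits.NavierStokesRegularity.NavierStokesRegularity.Theorems.AxisymmetricExtremalityAxisymmetricKatoGlobalStubSereginLogSwirlOriginLerayLogHardy
import Summits.NavierStokesRegularity.NavierStokesRegularity.Theorems.AxisymmetricExtremalityAxisymmetricKatoGlobalStubSereginLogSwirlOriginStep13Tools
import Literature.Analysis.FluidPDE.SqIntegralBalance
import HarnessLib

/-!
# Seregin 2022, §2 Step 3: the bound of `B₃ = −2∫(v_θ/r)(η³Φ)(η³Γ)` by the swirl decay (2.2) and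
# the log-Hardy inequality (Lemma 2.2), with explicit constants —
# crux stmt-NavierStokesRegularity-15453 (`AxisymmetricExtremality.AxisymmetricKatoGlobal`), line registered, support for stub `stub_sereginLogSwirlOrigin`

Support file (`--supports stmt-NavierStokesRegularity-15453`; theorems only, everything proved)
toward the registered stub `stub_sereginLogSwirlOrigin` = the named fact
`Literature.Analysis.FluidPDE.seregin2022_logSwirl_regularAtOrigin` (G. Seregin, J. Math. Fluid
Mech. 24 (2022), Paper 27 = arXiv:2201.00153, §2). Step 3, arXiv p. 6:
"`B₃ = −2∫_{S₁}(v_θ/r)(η³Φ)(η³Γ) + (1/r₁)C(v,η) ≤ (cC₁/ln(e/r₁))(∫|η³Γ|²/(r²ln²(e/r)))^{1/2}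
(∫|η³Φ|²/(r²ln²(e/r)))^{1/2} + (1/r₁)C(v,η)` … Applying Lemma 2.2, we find
`B₃ ≤ (cC₁/ln(e/r₁))‖∇_{x'}(η³Γ)‖‖∇_{x'}(η³Φ)‖ + (1/r₁)C(v,η)`" (`S₁ = {r < r₁}`, using (2.2)
`|σ| = r|v_θ| ≤ cC₁/ln³(e/r)`).

* `log_exp_div_eq` — `ln(e/r) = 1 − ln r`;
* `abs_integral_angVelQuot_mul_mul_le` (registered sub-goal) — **the `B₃` bound**: for an
  axisymmetric `u ∈ C²` with `|σ| ≤ C₁/ln³(e/r)` on `0 < r < r₁ < 1`, `f, g ∈ C¹` supported in the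
  cylinder `𝒞 = spaceCyl 0 1`, and `|(v_θ/r)fg| ≤ M` on `{r ≥ r₁}` (`v_θ/r = angVelQuot u`; the
  paper's `(1/r₁)C(v,η)`):
  `|∫(v_θ/r) f g| ≤ (2C₁/ln(e/r₁))(∫|∇_{x'}f|² + ∫|∇_{x'}g|²) + M·|B(0,2)|`.
  Proof: a.e. (off the axis) near the axis `|v_θ/r| ≤ C₁/(r²ln³(e/r))`
  (`abs_angVelQuot_le_of_swirl_le`) and `ln(e/r) ≥ ln(e/r₁) > 1`, so
  `|(v_θ/r)fg| ≤ (C₁/ln(e/r₁))·(|f|/(r ln(e/r)))(|g|/(r ln(e/r))) ≤ (C₁/(2ln(e/r₁)))(F + G)`,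
  `F = f²/(r²ln²(e/r))`; away from it the pointwise bound on `𝒞 ⊆ B(0,2)`; integrate and apply
  Lemma 2.2 (`integrable_and_integral_sq_div_logWeight_le`: `∫F ≤ 4∫|∇_{x'}f|²`).

Used with `f = η³Γ`, `g = η³Φ` in the absorption (`…Step3Absorb`).

## Mathlib / tree search

Tree: `integrable_and_integral_sq_div_logWeight_le`, `spaceCyl_subset_closedBall`
(`…LerayLogHardy`), `abs_angVelQuot_le_of_swirl_le` (`…Step13Tools`), `contDiff_angVelQuot`,
`volume_setOf_cylRadius_eq_zero` (`SqIntegralBalance`). Mathlib: `integral_mono_ae`,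
`abs_integral_le_integral_abs`, `integral_indicator_one`, `two_mul_le_add_sq`,
`Continuous.integrable_of_hasCompactSupport`. `lean search 'angVelQuot_mul_mul|integral_B3'`:
no matches (2026-08-17).

## References

* G. Seregin, J. Math. Fluid Mech. 24 (2022), Paper No. 27 = arXiv:2201.00153, §2 Step 3
  (arXiv p. 6, the estimate of `B₃`; Lemma 2.2). [`Seregin2022LocalAxisym`]
-/

noncomputable section

open MeasureTheory Set Filter Topology Function Metric
open scoped ENNReal ContDiff
open Literature.Analysis.FluidPDE

-- `<Problem> = <Summit>` duplicates a namespace component by design (lakefile sets the same option).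
set_option linter.dupNamespace false

namespace Summit.NavierStokesRegularity.NavierStokesRegularity.Theorems.AxisymmetricKatoGlobal.EulerScaling

section B3

variable {u : EuclideanSpace ℝ (Fin 3) → EuclideanSpace ℝ (Fin 3)} {f g : EuclideanSpace ℝ (Fin 3) → ℝ}

/-- `ln(e/r) = 1 − ln r` for `r > 0`, hence `ln(e/r₁) ≤ ln(e/r)` for `0 < r ≤ r₁` and
`1 < ln(e/r₁)` for `r₁ < 1`. [folklore] -/
theorem log_exp_div_eq (r : ℝ) (hr : 0 < r) : Real.log (Real.exp 1 / r) = 1 - Real.log r := by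
  rw [Real.log_div (Real.exp_pos 1).ne' hr.ne', Real.log_exp]

/-- **Seregin 2022, §2 Step 3, the bound of `B₃ = −2∫(v_θ/r)(η³Φ)(η³Γ)`** via (2.2) and
Lemma 2.2 (arXiv p. 6: "`B₃ ≤ (cC₁/ln(e/r₁)) (∫|η³Γ|²/(r²ln²(e/r)))^{1/2}(∫|η³Φ|²/(r²ln²(e/r)))^{1/2}
+ (1/r₁)C(v,η) ≤ (cC₁/ln(e/r₁))‖∇_{x'}(η³Γ)‖‖∇_{x'}(η³Φ)‖ + (1/r₁)C(v,η)`"), fixed time, with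
explicit constants. For an axisymmetric `u ∈ C²` whose swirl obeys `|σ| ≤ C₁/ln³(e/r)` on
`0 < r < r₁` (`r₁ < 1`), `f, g ∈ C¹` supported in the cylinder `𝒞 = spaceCyl 0 1`, and a bound
`|(v_θ/r) f g| ≤ M` on `{r ≥ r₁}` (`v_θ/r = angVelQuot u`):
`|∫ (v_θ/r) f g| ≤ (2C₁/ln(e/r₁)) (∫|∇_{x'}f|² + ∫|∇_{x'}g|²) + M·|B(0,2)|`
(near the axis `|v_θ/r| ≤ C₁/(r²ln³(e/r)) ≤ (C₁/ln(e/r₁))·1/(r²ln²(e/r))`, `ab ≤ (a²+b²)/2`, and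
`seregin2022_lemma22`; away from it the pointwise bound on `𝒞 ⊆ B(0,2)`).
[cite: Seregin2022LocalAxisym, §2 Step 3, estimate of B₃ (arXiv:2201.00153 p. 6)] -/
theorem abs_integral_angVelQuot_mul_mul_le : ∀ (u : EuclideanSpace ℝ (Fin 3) → EuclideanSpace ℝ (Fin 3)) (f g : EuclideanSpace ℝ (Fin 3) → ℝ) (C₁ r₁ M : ℝ), IsAxisymmetric u → ContDiff ℝ 2 u → ContDiff ℝ 1 f → ContDiff ℝ 1 g → tsupport f ⊆ SereginSverak2009.spaceCyl 0 1 → tsupport g ⊆ SereginSverak2009.spaceCyl 0 1 → 0 ≤ C₁ → 0 < r₁ → r₁ < 1 → 0 ≤ M → (∀ x, 0 < cylRadius x → cylRadius x < r₁ → |swirl u x| ≤ C₁ / Real.log (Real.exp 1 / cylRadius x) ^ 3) → (∀ x, r₁ ≤ cylRadius x → |angVelQuot u x * f x * g x| ≤ M) → |∫ x, angVelQuot u x * f x * g x| ≤ 2 * C₁ / Real.log (Real.exp 1 / r₁) * ((∫ x, (fderiv ℝ f x (EuclideanSpace.single 0 1) ^ 2 + fderiv ℝ f x (EuclideanSpace.single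 1 1) ^ 2)) + ∫ x, (fderiv ℝ g x (EuclideanSpace.single 0 1) ^ 2 + fderiv ℝ g x (EuclideanSpace.single 1 1) ^ 2)) + M * volume.real (closedBall (0 : EuclideanSpace ℝ (Fin 3)) 2) := by
  intro u f g C₁ r₁ M hax hu hf hg hfs hgs hC₁ hr₁ hr₁1 hM hσ hfar
  set L₁ : ℝ := Real.log (Real.exp 1 / r₁) with hL₁
  have hL₁1 : 1 < L₁ := by
    rw [hL₁, log_exp_div_eq r₁ hr₁]
    linarith [Real.log_neg hr₁ hr₁1]
  have hL₁0 : 0 < L₁ := by linarith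
  -- the weighted squares and Lemma 2.2
  set F : EuclideanSpace ℝ (Fin 3) → ℝ := fun x =>
    f x ^ 2 / (cylRadius x ^ 2 * Real.log (Real.exp 1 / cylRadius x) ^ 2) with hF
  set G : EuclideanSpace ℝ (Fin 3) → ℝ := fun x =>
    g x ^ 2 / (cylRadius x ^ 2 * Real.log (Real.exp 1 / cylRadius x) ^ 2) with hG
  obtain ⟨hFi, hFle⟩ := integrable_and_integral_sq_div_logWeight_le hf hfs
  obtain ⟨hGi, hGle⟩ := integrable_and_integral_sq_div_logWeight_le hg hgs
  have hF0 : ∀ x, 0 ≤ F x := fun x => by positivity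
  have hG0 : ∀ x, 0 ≤ G x := fun x => by positivity
  -- supports
  have hcs : HasCompactSupport f :=
    IsCompact.of_isClosed_subset (isCompact_closedBall (0 : EuclideanSpace ℝ (Fin 3)) 2)
      (isClosed_tsupport f) (hfs.trans spaceCyl_subset_closedBall)
  have hfzero : ∀ x, x ∉ closedBall (0 : EuclideanSpace ℝ (Fin 3)) 2 → f x = 0 := fun x hx =>
    image_eq_zero_of_notMem_tsupport fun h => hx (spaceCyl_subset_closedBall (hfs h))
  -- the integrand is continuous with compact support
  set w : EuclideanSpace ℝ (Fin 3) → ℝ := fun x => angVelQuot u x * f x * g x with hw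
  have hΦc : Continuous (angVelQuot u) := (contDiff_angVelQuot (n := 0) (by exact_mod_cast hu)).continuous
  have hwc : Continuous w := (hΦc.mul hf.continuous).mul hg.continuous
  have hwcs : HasCompactSupport w := (hcs.mul_left).mul_right
  have hwi : Integrable w := hwc.integrable_of_hasCompactSupport hwcs
  -- the indicator of the ball
  set χ : EuclideanSpace ℝ (Fin 3) → ℝ := (closedBall (0 : EuclideanSpace ℝ (Fin 3)) 2).indicator 1 with hχ
  have hχi : Integrable χ := by
    rw [hχ]
    exact (integrable_indicator_iff measurableSet_closedBall).2
      ((integrableOn_const_iff).2 (Or.inr (isCompact_closedBall _ _).measure_lt_top))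
  have hχ0 : ∀ x, 0 ≤ χ x := fun x => by
    rw [hχ]; exact indicator_nonneg (fun _ _ => zero_le_one) x
  -- the pointwise a.e. bound
  have hae : ∀ᵐ x ∂(volume : Measure (EuclideanSpace ℝ (Fin 3))), cylRadius x ≠ 0 := by
    rw [ae_iff]; simp only [ne_eq, not_not]; exact volume_setOf_cylRadius_eq_zero
  have hbound : ∀ᵐ x ∂(volume : Measure (EuclideanSpace ℝ (Fin 3))),
      |w x| ≤ C₁ / (2 * L₁) * (F x + G x) + M * χ x := by
    filter_upwards [hae] with x hx0
    have hr : 0 < cylRadius x := lt_of_le_of_ne (cylRadius_nonneg x) (Ne.symm hx0)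
    by_cases hnear : cylRadius x < r₁
    · -- near the axis
      set r := cylRadius x with hrdef
      set L := Real.log (Real.exp 1 / r) with hLdef
      have hLL : L₁ ≤ L := by
        rw [hLdef, hL₁, log_exp_div_eq r hr, log_exp_div_eq r₁ hr₁]
        linarith [Real.log_le_log hr hnear.le]
      have hL0 : 0 < L := by linarith
      have hq := abs_angVelQuot_le_of_swirl_le hax hu hr (hσ x hr hnear)
      -- `|Φ f g| ≤ C₁ |f||g| /(r² L³) ≤ (C₁/(2L₁)) (F + G)`
      have h1 : |w x| ≤ C₁ / (r ^ 2 * L ^ 3) * (|f x| * |g x|) := by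
        rw [hw]; simp only
        rw [abs_mul, abs_mul, mul_assoc]
        exact mul_le_mul_of_nonneg_right hq (by positivity)
      have hFx : F x = (f x / (r * L)) ^ 2 := by rw [hF]; simp only; rw [← hrdef, ← hLdef]; ring
      have hGx : G x = (g x / (r * L)) ^ 2 := by rw [hG]; simp only; rw [← hrdef, ← hLdef]; ring
      have h2 : C₁ / (r ^ 2 * L ^ 3) * (|f x| * |g x|) =
          (C₁ / L) * ((|f x| / (r * L)) * (|g x| / (r * L))) := by
        field_simp
      have h3 : (|f x| / (r * L)) * (|g x| / (r * L)) ≤ (F x + G x) / 2 := by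
        rw [hFx, hGx]
        have := two_mul_le_add_sq (|f x| / (r * L)) (|g x| / (r * L))
        rw [div_pow, div_pow, sq_abs, sq_abs, ← div_pow, ← div_pow] at this
        linarith
      have h4 : C₁ / L ≤ C₁ / L₁ := div_le_div_of_nonneg_left hC₁ hL₁0 hLL
      calc |w x| ≤ C₁ / (r ^ 2 * L ^ 3) * (|f x| * |g x|) := h1
        _ = (C₁ / L) * ((|f x| / (r * L)) * (|g x| / (r * L))) := h2
        _ ≤ (C₁ / L₁) * ((F x + G x) / 2) :=
            mul_le_mul h4 h3 (by positivity) (by positivity)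
        _ = C₁ / (2 * L₁) * (F x + G x) := by field_simp
        _ ≤ C₁ / (2 * L₁) * (F x + G x) + M * χ x := le_add_of_nonneg_right (mul_nonneg hM (hχ0 x))
    · -- away from the axis
      push Not at hnear
      have hFG : 0 ≤ C₁ / (2 * L₁) * (F x + G x) := by
        have := hF0 x; have := hG0 x; positivity
      by_cases hxB : x ∈ closedBall (0 : EuclideanSpace ℝ (Fin 3)) 2
      · have hχx : χ x = 1 := by rw [hχ]; exact indicator_of_mem hxB _
        rw [hχx, mul_one]
        linarith [hfar x hnear]
      · have : w x = 0 := by rw [hw]; simp [hfzero x hxB]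
        rw [this, abs_zero]
        exact add_nonneg hFG (mul_nonneg hM (hχ0 x))
  -- integrate
  have hFGi : Integrable (fun x => F x + G x) := hFi.add hGi
  have h1i : Integrable (fun x => C₁ / (2 * L₁) * (F x + G x)) := hFGi.const_mul _
  have h2i : Integrable (fun x => M * χ x) := hχi.const_mul M
  have hRi : Integrable (fun x => C₁ / (2 * L₁) * (F x + G x) + M * χ x) := h1i.add h2i
  have hint : ∫ x, |w x| ≤ C₁ / (2 * L₁) * ((∫ x, F x) + ∫ x, G x) + M * volume.real (closedBall (0 : EuclideanSpace ℝ (Fin 3)) 2) := by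
    have h := integral_mono_ae hwi.abs hRi hbound
    rw [integral_add h1i h2i, MeasureTheory.integral_const_mul,
      MeasureTheory.integral_const_mul, integral_add hFi hGi] at h
    have hχint : ∫ x, χ x = volume.real (closedBall (0 : EuclideanSpace ℝ (Fin 3)) 2) := by
      rw [hχ]; exact integral_indicator_one measurableSet_closedBall
    rw [hχint] at h
    exact h
  have habs : |∫ x, w x| ≤ ∫ x, |w x| := abs_integral_le_integral_abs
  have hFG4 : (∫ x, F x) + ∫ x, G x ≤
      4 * ((∫ x, (fderiv ℝ f x (EuclideanSpace.single 0 1) ^ 2 + fderiv ℝ f x (EuclideanSpace.single 1 1) ^ 2)) +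
        ∫ x, (fderiv ℝ g x (EuclideanSpace.single 0 1) ^ 2 + fderiv ℝ g x (EuclideanSpace.single 1 1) ^ 2)) := by
    linarith [hFle, hGle]
  have hcoef : 0 ≤ C₁ / (2 * L₁) := by positivity
  calc |∫ x, w x| ≤ ∫ x, |w x| := habs
    _ ≤ C₁ / (2 * L₁) * ((∫ x, F x) + ∫ x, G x) + M * volume.real (closedBall (0 : EuclideanSpace ℝ (Fin 3)) 2) := hint
    _ ≤ C₁ / (2 * L₁) * (4 * ((∫ x, (fderiv ℝ f x (EuclideanSpace.single 0 1) ^ 2 +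
          fderiv ℝ f x (EuclideanSpace.single 1 1) ^ 2)) +
        ∫ x, (fderiv ℝ g x (EuclideanSpace.single 0 1) ^ 2 + fderiv ℝ g x (EuclideanSpace.single 1 1) ^ 2))) +
        M * volume.real (closedBall (0 : EuclideanSpace ℝ (Fin 3)) 2) := by
        gcongr
    _ = _ := by ring

end B3

end Summit.NavierStokesRegularity.NavierStokesRegularity.Theorems.AxisymmetricKatoGlobal.EulerScaling

end
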